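import Summits.AtomisticToContinuum.Crystallization.Theorems.FrustratedLawDichotomyCellHostMirror
import Summits.AtomisticToContinuum.Crystallization.Theorems.FrustratedLawDichotomyCellRemStar
import Summits.AtomisticToContinuum.Crystallization.Theorems.FrustratedLawDichotomyCellFarLabels

/-!
# FrustratedLawDichotomy · crux `AperiodicFrustratedLawGap` (stmt-AtomisticToContinuum-27623) — THE LABELS-SCALE MASTER: (251) PRE-COMPOSED
# WITH THE FAR-LABEL, MIRROR-HOST AND STAR-REMAINDER DISCHARGERS (decomp-a2c hand-1 g54; one call per Floor file, template-agnostic)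

`…CellTailsRem.lb_le_certFloorL_trunc` (251) is the exact hypothesis list a cell K-file discharges.  Under the LABELS-SCALE mechanics of
record (list-backed `M`, never enumerated) five of its hypotheses are produced by the tree dischargers (hand-1 g54):
`hMNc`/`hMLc` ((p860341) `hMNc_of_radii`/`hMLc_of_radius`), `hnbh`/`hhf` ((p860245) `hnbh_of_window`/`hhf_of_mirror`, mirror host column of
record r1805 (B5)), `hRM` ((p860355) `hRM_of_star`).  This file composes them ONCE:

★★★ `lb_le_certFloorL_scale` — the master with the LISTS OF RECORD (`nb := ballL M z ℓ_n`, `nbr := ballL M z ℓ_r`, `nbh := mirrorNbh M mir`,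
`MN`/`ML` any explicit lists that are predicate-supersets of `{m ≠ o : |z m|² < ℓ_N}` / `{… < ℓ_D}`) and, in place of the five hypotheses,
their PREDICATE-LEVEL inputs: integer radii `ℓ_A ℓ_n ℓ_N ℓ_D ℓ_r` with rational `A, B` (`ℓ_A ≤ A²`, `ℓ_n ≤ B²`, `(A+B)² ≤ ℓ_N`), the caller's
metric conversions (`ℓ ≤ |z m|² ⇒ L ≤ ‖pos m‖`, `x ∉ ballL … ⇒ L ≤ dist`: (261)/(270) one-liners on the cell), the label mirror `mir`
(bond reversal, involution, admissibility closure, window completeness `hout`, radii `δ/2 ≤ Lh m`, `Lh m + ‖pos m‖ ≤ R_w`), the star table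
(`dk`, `D`, `g`) with interior norm witnesses `yb`, and the per-label numbers `host deb nn hf fc`, `SY`, `tc` exactly as in (251).  Conclusion:
`Σ host − (Σ_{ML} deb + debTail) − τ(Σ_{MN} nn + T0_δ(R_N) + 2·SY·TL_δ(L_N)) − Σ_{MI} hf − Σ_{MI} fc − ((Σ_{MI} yb)·(Σ_D g) + SY·remTail) − tc
 ≤ certFloorL` — so a Floor file is: data, the decided predicate facts, the class/NASH readings, ONE call.
Template-agnostic (`pos`, `Y` arbitrary; TOY ROW 4M is the worked instance for `h•z`).  DEF-FREE; imports TREE `…CellHostMirror`,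
`…CellRemStar`, `…CellFarLabels`; 0 sorry.  All `[folklore]`.
-/

noncomputable section

namespace Summit.AtomisticToContinuum.Crystallization.Theorems.FrustratedLawDichotomyCellMasterScale

open Metric Set RealInnerProductSpace
open scoped BigOperators
open Summit.AtomisticToContinuum.Crystallization.Theorems.ChargedEnergyGapNegative (E3)
open Summit.AtomisticToContinuum.Crystallization.Theorems.FrustratedLawDichotomyCoherentFloorAlgebra
open Summit.AtomisticToContinuum.Crystallization.Theorems.FrustratedLawDichotomyCoherentFloor (farCol tailCol)
open Summit.AtomisticToContinuum.Crystallization.Theorems.FrustratedLawDichotomyCellFrame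
open Summit.AtomisticToContinuum.Crystallization.Theorems.FrustratedLawDichotomyCellTails
open Summit.AtomisticToContinuum.Crystallization.Theorems.FrustratedLawDichotomyCellTailsRem
open Summit.AtomisticToContinuum.Crystallization.Theorems.FrustratedLawDichotomyCellClasses (ballL)
open Summit.AtomisticToContinuum.Crystallization.Theorems.FrustratedLawDichotomyCellHostMirror
open Summit.AtomisticToContinuum.Crystallization.Theorems.FrustratedLawDichotomyCellRemInterior
open Summit.AtomisticToContinuum.Crystallization.Theorems.FrustratedLawDichotomyCellRemStar
open Summit.AtomisticToContinuum.Crystallization.Theorems.FrustratedLawDichotomyCellFarLabels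

variable {ι : Type*} [DecidableEq ι]

/-- ★★★ **THE LABELS-SCALE MASTER.**  (251) `lb_le_certFloorL_trunc` with the lists of record and the five «∀ over M» / pair-list hypotheses
replaced by their predicate-level inputs (far labels by radii, host column by mirror, remainder by the star table). [folklore] -/
theorem lb_le_certFloorL_scale {M MI : Finset ι} {pos Y : ι → E3} (o : ι) {τ Rc δ L_N R_N L_D L_R : ℝ} (hτ0 : 0 ≤ τ) (hδ : 0 < δ)
    (hsep : ∀ z ∈ M, ∀ z' ∈ M, z ≠ z' → δ ≤ dist (pos z) (pos z')) (hMI : MI ⊆ M)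
    -- integer label coordinates and radii of record
    (z : ι → Fin 3 → ℤ) {ℓA ℓn ℓN ℓD ℓr : ℤ} {A B : ℚ}
    (hMIA : ∀ x ∈ MI, ∑ i, z x i ^ 2 < ℓA) (hAN : ℓA ≤ ℓN) (h0A : 0 ≤ A) (h0B : 0 ≤ B)
    (hA : (ℓA : ℚ) ≤ A ^ 2) (hB : (ℓn : ℚ) ≤ B ^ 2) (hAB : (A + B) ^ 2 ≤ (ℓN : ℚ))
    -- NASH column: explicit near list `MN ⊇ {m ≠ o : |z m|² < ℓ_N}` (by predicate), near bonds `ballL M z ℓ_n`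
    (MN : Finset ι) (hLN : δ / 2 ≤ L_N) (hRN : δ / 2 ≤ R_N) (hMN : MN ⊆ M.erase o)
    (hMNsup : ∀ m ∈ M, m ≠ o → ∑ i, z m i ^ 2 < ℓN → m ∈ MN)
    (hnbL : ∀ c ∈ M, ∀ x ∈ M, x ≠ c → x ∉ ballL M z ℓn c → L_N ≤ dist (pos x) (pos c))
    (hfarN : ∀ m ∈ M, ℓN ≤ ∑ i, z m i ^ 2 → R_N ≤ ‖pos m‖)
    -- root-bond debits: explicit near-root list `ML ⊇ {m ≠ o : |z m|² < ℓ_D}`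
    (ML : Finset ι) (hLD : δ / 2 ≤ L_D) (hτD : τ < L_D) (hML : ML ⊆ M.erase o)
    (hMLsup : ∀ m ∈ M, m ≠ o → ∑ i, z m i ^ 2 < ℓD → m ∈ ML) (hfarD : ∀ m ∈ M, ℓD ≤ ∑ i, z m i ^ 2 → L_D ≤ ‖pos m‖)
    -- force remainder: near-pair lists `ballL M z ℓ_r`, the STAR TABLE
    (hLR : δ / 2 ≤ L_R) (hτR : 2 * τ < L_R)
    (hnbrL : ∀ m ∈ M, ∀ m' ∈ M, m' ≠ m → m' ∉ ballL M z ℓr m → L_R ≤ dist (pos m') (pos m))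
    {κ : Type*} [DecidableEq κ] (dk : ι → ι → κ) (hinjdk : ∀ x ∈ MI, Set.InjOn (dk x) ↑M) (D : Finset κ) (g : κ → ℝ)
    (hg : ∀ d ∈ D, 0 ≤ g d) (hD : ∀ x ∈ MI, ∀ m' ∈ M, m' ≠ x → m' ∈ ballL M z ℓr x → dk x m' ∈ D)
    (hwg : ∀ x ∈ MI, ∀ m' ∈ M, m' ≠ x → m' ∈ ballL M z ℓr x →
      forceRem ‖pos x - pos m'‖ (dispL o τ x + dispL o τ m') ≤ g (dk x m'))
    (yb : ι → ℝ) (hyb : ∀ x ∈ MI, ‖Y x‖ ≤ yb x)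
    -- host-force pairings: THE MIRROR CORE
    (mir : ι → ι → ι) (hrev : ∀ m ∈ MI, ∀ m' ∈ M, pos m - pos (mir m m') = -(pos m - pos m'))
    (hinv : ∀ m ∈ MI, ∀ m' ∈ M, mir m (mir m m') = m') {adm : ι → Prop} {R_w : ℝ}
    (hadm : ∀ m ∈ MI, ∀ m' ∈ M, adm (mir m m')) (hout : ∀ x, adm x → x ∉ M → R_w ≤ ‖pos x‖)
    (Lh : ι → ℝ) (hLh : ∀ m ∈ MI, δ / 2 ≤ Lh m) (hLw : ∀ m ∈ MI, Lh m + ‖pos m‖ ≤ R_w)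
    -- the certified numbers
    (host : ι → ℝ) (hhost : ∀ m ∈ M.erase o, host m ≤ phiT (‖pos m‖ ^ 2))
    (deb : ι → ℝ) (hdeb : ∀ m ∈ ML, τ ^ 2 * secondNeg ‖pos m‖ + energyRem ‖pos m‖ τ ≤ deb m)
    (nn : ι → ℝ) (hnn : ∀ m ∈ MN, ‖psiT (‖pos m‖ ^ 2) • pos m - certCoeffNearL M MI pos Y (ballL M z ℓn) m‖ ≤ nn m)
    (hf : ι → ℝ) (hhf : ∀ m ∈ MI, ‖Y m‖ * psiTail δ (Lh m) ≤ hf m)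
    (fc : ι → ℝ) (hfc : ∀ m ∈ MI, ‖Y m‖ * farCol (Rc - (‖pos m‖ + τ)) ≤ fc m)
    (SY : ℝ) (hSY : ∑ x ∈ MI, ‖Y x‖ ≤ SY) (tc : ℝ) (htc : tailCol Rc ≤ tc) :
    ∑ m ∈ M.erase o, host m - (∑ m ∈ ML, deb m + debTail δ L_D τ)
        - τ * (∑ m ∈ MN, nn m + psiTail δ R_N + 2 * SY * linTail δ L_N)
        - ∑ m ∈ MI, hf m - ∑ m ∈ MI, fc m - ((∑ x ∈ MI, yb x) * (∑ d ∈ D, g d) + SY * remTail δ L_R τ) - tc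
      ≤ certFloorL M MI o pos Y τ Rc := by
  have hinj : Set.InjOn pos ↑M := injOn_of_sep hδ hsep
  exact lb_le_certFloorL_trunc (M := M) (MI := MI) (pos := pos) (Y := Y) o hτ0 hδ hsep hMI
    MN (ballL M z ℓn) hLN hRN hnbL hMN
    (hMNc_of_radii (M := M) (MI := MI) (pos := pos) (z := z) o hMNsup hMIA hAN h0A h0B hA hB hAB hfarN)
    ML hLD hτD hML (hMLc_of_radius (M := M) (pos := pos) (z := z) o hMLsup hfarD)
    (ballL M z ℓr) hLR hτR hnbrL
    (mirrorNbh M mir) Lh hLh (hnbh_of_window (MI := MI) hout hadm hrev hLw)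
    host hhost deb hdeb nn hnn
    hf (hhf_of_mirror hinj hMI hrev hinv hhf)
    fc hfc ((∑ x ∈ MI, yb x) * ∑ d ∈ D, g d)
    (hRM_of_star (pos := pos) (Y := Y) (nbr := ballL M z ℓr) o hτ0 hMI (ballL_hsym M z ℓr) dk hinjdk D g hg hD hwg yb hyb)
    SY hSY tc htc

/-- ★★★ **THE LABELS-SCALE MASTER, LOCAL-WINDOW FORM** (appended, hand-1 g54): as `lb_le_certFloorL_scale`, but the mirror host column's
window completeness is LOCAL — per interior label `m`, every admissible label within `Lh m` of `pos m` lies in `M` (`houtL`, contrapositive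
form; (p860245 §6) `hnbh_of_local`) — so the label set need NOT be a root-centred ball: class-H half-space cells (253) and cut cells, whose
interior labels sit at depth `≥ Lh m` below the cut.  The root-centred master is the special case
`houtL := houtL_of_window hout (hLw m)`. [folklore] -/
theorem lb_le_certFloorL_scaleLocal {M MI : Finset ι} {pos Y : ι → E3} (o : ι) {τ Rc δ L_N R_N L_D L_R : ℝ} (hτ0 : 0 ≤ τ) (hδ : 0 < δ)
    (hsep : ∀ z ∈ M, ∀ z' ∈ M, z ≠ z' → δ ≤ dist (pos z) (pos z')) (hMI : MI ⊆ M)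
    (z : ι → Fin 3 → ℤ) {ℓA ℓn ℓN ℓD ℓr : ℤ} {A B : ℚ}
    (hMIA : ∀ x ∈ MI, ∑ i, z x i ^ 2 < ℓA) (hAN : ℓA ≤ ℓN) (h0A : 0 ≤ A) (h0B : 0 ≤ B)
    (hA : (ℓA : ℚ) ≤ A ^ 2) (hB : (ℓn : ℚ) ≤ B ^ 2) (hAB : (A + B) ^ 2 ≤ (ℓN : ℚ))
    (MN : Finset ι) (hLN : δ / 2 ≤ L_N) (hRN : δ / 2 ≤ R_N) (hMN : MN ⊆ M.erase o)
    (hMNsup : ∀ m ∈ M, m ≠ o → ∑ i, z m i ^ 2 < ℓN → m ∈ MN)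
    (hnbL : ∀ c ∈ M, ∀ x ∈ M, x ≠ c → x ∉ ballL M z ℓn c → L_N ≤ dist (pos x) (pos c))
    (hfarN : ∀ m ∈ M, ℓN ≤ ∑ i, z m i ^ 2 → R_N ≤ ‖pos m‖)
    (ML : Finset ι) (hLD : δ / 2 ≤ L_D) (hτD : τ < L_D) (hML : ML ⊆ M.erase o)
    (hMLsup : ∀ m ∈ M, m ≠ o → ∑ i, z m i ^ 2 < ℓD → m ∈ ML) (hfarD : ∀ m ∈ M, ℓD ≤ ∑ i, z m i ^ 2 → L_D ≤ ‖pos m‖)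
    (hLR : δ / 2 ≤ L_R) (hτR : 2 * τ < L_R)
    (hnbrL : ∀ m ∈ M, ∀ m' ∈ M, m' ≠ m → m' ∉ ballL M z ℓr m → L_R ≤ dist (pos m') (pos m))
    {κ : Type*} [DecidableEq κ] (dk : ι → ι → κ) (hinjdk : ∀ x ∈ MI, Set.InjOn (dk x) ↑M) (D : Finset κ) (g : κ → ℝ)
    (hg : ∀ d ∈ D, 0 ≤ g d) (hD : ∀ x ∈ MI, ∀ m' ∈ M, m' ≠ x → m' ∈ ballL M z ℓr x → dk x m' ∈ D)
    (hwg : ∀ x ∈ MI, ∀ m' ∈ M, m' ≠ x → m' ∈ ballL M z ℓr x →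
      forceRem ‖pos x - pos m'‖ (dispL o τ x + dispL o τ m') ≤ g (dk x m'))
    (yb : ι → ℝ) (hyb : ∀ x ∈ MI, ‖Y x‖ ≤ yb x)
    -- host-force pairings: THE MIRROR CORE with LOCAL completeness radii
    (mir : ι → ι → ι) (hrev : ∀ m ∈ MI, ∀ m' ∈ M, pos m - pos (mir m m') = -(pos m - pos m'))
    (hinv : ∀ m ∈ MI, ∀ m' ∈ M, mir m (mir m m') = m') {adm : ι → Prop}
    (hadm : ∀ m ∈ MI, ∀ m' ∈ M, adm (mir m m')) (Lh : ι → ℝ) (hLh : ∀ m ∈ MI, δ / 2 ≤ Lh m)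
    (houtL : ∀ m ∈ MI, ∀ x, adm x → x ∉ M → Lh m ≤ dist (pos x) (pos m))
    (host : ι → ℝ) (hhost : ∀ m ∈ M.erase o, host m ≤ phiT (‖pos m‖ ^ 2))
    (deb : ι → ℝ) (hdeb : ∀ m ∈ ML, τ ^ 2 * secondNeg ‖pos m‖ + energyRem ‖pos m‖ τ ≤ deb m)
    (nn : ι → ℝ) (hnn : ∀ m ∈ MN, ‖psiT (‖pos m‖ ^ 2) • pos m - certCoeffNearL M MI pos Y (ballL M z ℓn) m‖ ≤ nn m)
    (hf : ι → ℝ) (hhf : ∀ m ∈ MI, ‖Y m‖ * psiTail δ (Lh m) ≤ hf m)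
    (fc : ι → ℝ) (hfc : ∀ m ∈ MI, ‖Y m‖ * farCol (Rc - (‖pos m‖ + τ)) ≤ fc m)
    (SY : ℝ) (hSY : ∑ x ∈ MI, ‖Y x‖ ≤ SY) (tc : ℝ) (htc : tailCol Rc ≤ tc) :
    ∑ m ∈ M.erase o, host m - (∑ m ∈ ML, deb m + debTail δ L_D τ)
        - τ * (∑ m ∈ MN, nn m + psiTail δ R_N + 2 * SY * linTail δ L_N)
        - ∑ m ∈ MI, hf m - ∑ m ∈ MI, fc m - ((∑ x ∈ MI, yb x) * (∑ d ∈ D, g d) + SY * remTail δ L_R τ) - tc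
      ≤ certFloorL M MI o pos Y τ Rc := by
  have hinj : Set.InjOn pos ↑M := injOn_of_sep hδ hsep
  exact lb_le_certFloorL_trunc (M := M) (MI := MI) (pos := pos) (Y := Y) o hτ0 hδ hsep hMI
    MN (ballL M z ℓn) hLN hRN hnbL hMN
    (hMNc_of_radii (M := M) (MI := MI) (pos := pos) (z := z) o hMNsup hMIA hAN h0A h0B hA hB hAB hfarN)
    ML hLD hτD hML (hMLc_of_radius (M := M) (pos := pos) (z := z) o hMLsup hfarD)
    (ballL M z ℓr) hLR hτR hnbrL
    (mirrorNbh M mir) Lh hLh (hnbh_of_local (MI := MI) houtL hadm hrev)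
    host hhost deb hdeb nn hnn
    hf (hhf_of_mirror hinj hMI hrev hinv hhf)
    fc hfc ((∑ x ∈ MI, yb x) * ∑ d ∈ D, g d)
    (hRM_of_star (pos := pos) (Y := Y) (nbr := ballL M z ℓr) o hτ0 hMI (ballL_hsym M z ℓr) dk hinjdk D g hg hD hwg yb hyb)
    SY hSY tc htc

end Summit.AtomisticToContinuum.Crystallization.Theorems.FrustratedLawDichotomyCellMasterScale

end
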